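import Summits.HodgeConjecture.HodgeCM.PerL34.GenuineSchrodingerCoeff_1

/-! PORT of `HodgeCM/PerL34/GenuineSchrodingerCoeff.lean` (HodgeCMPerL run 82) — part 2: continuation of `Summits.HodgeConjecture.HodgeCM.PerL34.GenuineSchrodingerCoeff_1` (split at a top-level declaration boundary by port_pkg.py; scope re-opened below; declarations unchanged). -/

-- port_pkg: scope re-opened for this part (file-level context, then the namespace/section stack open at the cut)
set_option linter.style.longFile 0
set_option linter.unusedSectionVars false
set_option linter.unusedVariables false
noncomputable section
open MeasureTheory MeasureTheory.Measure Set Metric Function Complex ComplexConjugate Topology Filter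
open scoped RestrictedProduct InnerProductSpace NNReal ENNReal Pointwise
namespace HodgeCM.PerL34.PureTensor
open HodgeCM.PerL34.LocalFactors HodgeCM.PerL34.LocalFactors.DilationModel
open HodgeCM.PerL34.IdelePlaces HodgeCM.PerL34.RestrictedRegroup HodgeCM.PerL34.RestrictedCutout
open HodgeCM.PerL34.IdelicTorusModel HodgeCM.PerL34.IdelicTorusModel.Genuine NumberField IsDedekindDomain
open HodgeCM.PerL34.NoSmallSubgroups
attribute [local instance] LocalFactors.DilationModel.Adic.nontriviallyNormedField
  LocalFactors.DilationModel.Adic.properSpace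
namespace SchrodingerModel
variable {L : Type} [Field L] [NumberField L] [IsCMField L]
local notation3 "L⁺" => maximalRealSubfield L
local notation3 "𝕂" i => (basePlaceOf L (Subtype.val i)).adicCompletion (maximalRealSubfield L)
namespace Coeff
section Main
variable [∀ v : HeightOneSpectrum (𝓞 (maximalRealSubfield L)), MeasurableSpace (v.adicCompletion (maximalRealSubfield L))]
  [∀ v : HeightOneSpectrum (𝓞 (maximalRealSubfield L)), BorelSpace (v.adicCompletion (maximalRealSubfield L))]
  [DecidableEq (Place (maximalRealSubfield L))]
/-- **the diagonal coefficient of `φ⁰`**: `⟪φ⁰, ω_ν(k) φ⁰⟫ = weight_ν(k) · ∏_{j ∈ S} vol_j(𝒪³ ∩ u_j⁻¹ 𝒪³)` for any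
finite `S` of split indices off which the split coordinates `u_j` of `k` have norm one. -/
theorem inner_phi0_rep (ν : Model L →* Circle) (k : Model L) (S : Finset (SplitIdx L))
    (hS : ∀ j : SplitIdx L, j ∉ S → ‖((unitAt k j : (𝕂 j)ˣ) : 𝕂 j)‖ = 1) :
    ⟪phi0 L, rep L ν k (phi0 L)⟫_ℂ = weight (Space L) ν k * ((∏ j ∈ S, locVol j (unitAt k j)).toReal : ℂ) := by
  have h := inner_indicator_dilationRep (μ L) ν k (isOpen_box L).measurableSet (by rw [μ_box]; exact ENNReal.one_ne_top)
  rw [phi0]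
  rw [h, measureReal_def, measure_box_inter_preimage_smul_box k S hS]

/-- split coordinate of an element trivial at the underlying place -/
theorem unitAt_eq_one_of_apply_eq_one {k : Model L} {j : SplitIdx L} (h : k j.1 = 1) : unitAt k j = 1 := by
  rw [unitAt, h, map_one]

/-- **multiplicativity on disjointly supported pairs** of the diagonal coefficient of `φ⁰` -/
theorem inner_phi0_rep_mul_of_disjoint (ν : Model L →* Circle) :
    ∀ a b : Model L, (∀ i, a i = 1 ∨ b i = 1) →
      ⟪phi0 L, rep L ν (a * b) (phi0 L)⟫_ℂ = ⟪phi0 L, rep L ν a (phi0 L)⟫_ℂ * ⟪phi0 L, rep L ν b (phi0 L)⟫_ℂ := by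
  intro a b hab
  set S : Finset (SplitIdx L) := exc a ∪ exc b with hSdef
  have ha : ∀ j : SplitIdx L, j ∉ S → ‖((unitAt a j : (𝕂 j)ˣ) : 𝕂 j)‖ = 1 := fun j hj =>
    norm_unitAt_of_not_mem_exc a fun h => hj (Finset.mem_union_left _ h)
  have hb : ∀ j : SplitIdx L, j ∉ S → ‖((unitAt b j : (𝕂 j)ˣ) : 𝕂 j)‖ = 1 := fun j hj =>
    norm_unitAt_of_not_mem_exc b fun h => hj (Finset.mem_union_right _ h)
  have hab' : ∀ j : SplitIdx L, j ∉ S → ‖((unitAt (a * b) j : (𝕂 j)ˣ) : 𝕂 j)‖ = 1 := fun j hj => by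
    rw [unitAt_mul, Units.val_mul, norm_mul, ha j hj, hb j hj, one_mul]
  rw [inner_phi0_rep ν (a * b) S hab', inner_phi0_rep ν a S ha, inner_phi0_rep ν b S hb, weight_mul]
  have key : ∏ j ∈ S, locVol j (unitAt (a * b) j) = (∏ j ∈ S, locVol j (unitAt a j)) * ∏ j ∈ S, locVol j (unitAt b j) := by
    rw [← Finset.prod_mul_distrib]
    refine Finset.prod_congr rfl fun j _ => ?_
    rw [unitAt_mul]
    rcases hab j.1 with h | h
    · rw [unitAt_eq_one_of_apply_eq_one h, one_mul, locVol_one, one_mul]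
    · rw [unitAt_eq_one_of_apply_eq_one h, mul_one, locVol_one, mul_one]
  rw [key, ENNReal.toReal_mul, Complex.ofReal_mul]
  ring

/-- **`hM` of the END theorem** for the genuine split Schrödinger model (every finite `S`, every `ν`): the diagonal
coefficient of `φ⁰ = ⊗ 1_{𝒪_v³}` FACTORISES as the product of the local coefficients. -/
theorem inner_phi0_rep_extendOne (ν : Model L →* Circle) (S : Finset (Place L⁺)) (y : (i : ↥S) → locTorus L⁺ L i) :
    inner ℂ (phi0 L) (rep L ν (extendOne (genLevel L) S y) (phi0 L)) =
      ∏ i : ↥S, localCoeff (genLevel L) (rep L ν) (phi0 L) i (y i) :=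
  apply_extendOne_of_mulDisjoint (genLevel L) (fun k => inner ℂ (phi0 L) (rep L ν k (phi0 L)))
    (inner_map_one_of_norm_eq_one (genLevel L) (rep L ν) norm_phi0) (inner_phi0_rep_mul_of_disjoint ν) S y

/-- `hM` in the exact shape of the END binder (the hypothesis `T ⊆ S` is not needed) -/
theorem hM_phi0 (ν : Model L →* Circle) (T : Finset (Place L⁺)) :
    ∀ S : Finset (Place L⁺), T ⊆ S → ∀ y : (i : ↥S) → locTorus L⁺ L i,
      inner ℂ (phi0 L) (rep L ν (extendOne (genLevel L) S y) (phi0 L)) =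
        ∏ i : ↥S, localCoeff (genLevel L) (rep L ν) (phi0 L) i (y i) :=
  fun S _ y => inner_phi0_rep_extendOne ν S y

/-! ## §5  `hloc`: strong continuity on the local groups -/

/-- `ω_ν = ν · ω_1` -/
theorem rep_eq_smul_rep_one (ν : Model L →* Circle) (k : Model L) (w : Lp ℂ 2 (μ L)) :
    rep L ν k w = ((ν k : Circle) : ℂ) • rep L 1 k w := by
  apply Lp.ext
  filter_upwards [coeFn_dilationRep (μ L) ν k w, coeFn_dilationRep (μ L) (1 : Model L →* Circle) k w,
    Lp.coeFn_smul (((ν k : Circle) : ℂ)) (rep L 1 k w)] with x e1 e2 e3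
  rw [e1, e3, Pi.smul_apply, e2, smul_eq_mul, weight, weight, MonoidHom.one_apply, Circle.coe_one, one_mul,
    mul_assoc]

/-- on elements with all split coordinates of norm one, `ω_1(k)` is the `L²` pull-back along the measure-preserving
homeomorphism `x ↦ k • x` -/
theorem rep_one_eq_compMeasurePreserving (k : Model L) (hk : ∀ j : SplitIdx L, ‖((unitAt k j : (𝕂 j)ˣ) : 𝕂 j)‖ = 1)
    (w : Lp ℂ 2 (μ L)) :
    rep L 1 k w = Lp.compMeasurePreserving (fun x : Space L => k • x) (measurePreserving_smul_of_norm k hk) w := by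
  apply Lp.ext
  filter_upwards [coeFn_dilationRep (μ L) (1 : Model L →* Circle) k w,
    Lp.coeFn_compMeasurePreserving w (measurePreserving_smul_of_norm k hk)] with x e1 e2
  rw [e1, e2, weight_eq_of_norm 1 k hk, MonoidHom.one_apply, Circle.coe_one, one_mul, Function.comp_apply]

/-- the split coordinates of an embedded LEVEL element `ι_i(u)`, `u ∈ B_i`, all have norm one -/
theorem norm_unitAt_mulSingle_of_mem_genLevel (i : Place L⁺) {u : locTorus L⁺ L i} (hu : u ∈ genLevel L i)
    (j : SplitIdx L) :
    ‖((unitAt (RestrictedProduct.mulSingle (genLevel L) i u) j : (𝕂 j)ˣ) : 𝕂 j)‖ = 1 := by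
  by_cases hji : j.1 = i
  · subst hji
    rw [unitAt_mulSingle_self]
    exact (mem_genLevel_iff_norm_baseTriv_eq_one L j.1 j.2 u).1 hu
  · rw [unitAt_mulSingle_of_ne j hji, Units.val_one, norm_one]

/-- the split coordinate `u_j(ι_i g)` depends continuously on `g` -/
theorem continuous_unitAt_mulSingle (i : Place L⁺) (j : SplitIdx L) :
    Continuous fun g : locTorus L⁺ L i =>
      ((unitAt (RestrictedProduct.mulSingle (genLevel L) i g) j : (𝕂 j)ˣ) : 𝕂 j) := by
  by_cases hji : j.1 = i
  · subst hji
    simp_rw [unitAt_mulSingle_self]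
    exact Units.continuous_val.comp (map_continuous (baseTriv L j.1 j.2))
  · simp_rw [unitAt_mulSingle_of_ne j hji]
    exact continuous_const

/-- **joint continuity** of the level action `(u, x) ↦ ι_i(u) • x` on `B_i × X` (restricted-product topology:
a level element maps every `𝒪_j³` into itself, so the action restricts to each principal stage `X_S`). -/
theorem continuous_levelSMul (i : Place L⁺) :
    Continuous fun p : (genLevel L i) × Space L =>
      RestrictedProduct.mulSingle (genLevel L) i (p.1 : locTorus L⁺ L i) • p.2 := by
  rw [RestrictedProduct.continuous_dom_prod_left (fact_isOpen_cube L).out]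
  intro S hS
  -- the action at the principal stage `S`
  let F : (genLevel L i) × Πʳ j : SplitIdx L, [Coord L j, (cube L j : Set (Coord L j))]_[𝓟 S] →
      Πʳ j : SplitIdx L, [Coord L j, (cube L j : Set (Coord L j))]_[𝓟 S] := fun p =>
    ⟨fun j => ((unitAt (RestrictedProduct.mulSingle (genLevel L) i (p.1 : locTorus L⁺ L i)) j : (𝕂 j)ˣ) : 𝕂 j) • p.2 j,
      Filter.eventually_principal.2 fun j hj =>
        (smul_mem_cube_iff j (norm_unitAt_mulSingle_of_mem_genLevel i p.1.2 j) _).2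
          (Filter.eventually_principal.1 p.2.2 j hj)⟩
  have hF : Continuous F := by
    rw [RestrictedProduct.continuous_rng_of_principal]
    refine continuous_pi fun j => ?_
    exact ((continuous_unitAt_mulSingle i j).comp (continuous_subtype_val.comp continuous_fst)).smul
      ((continuous_apply j).comp (RestrictedProduct.continuous_coe.comp continuous_snd))
  have hcomp : (fun p : (genLevel L i) × Space L =>
      RestrictedProduct.mulSingle (genLevel L) i (p.1 : locTorus L⁺ L i) • p.2) ∘
        Prod.map id (RestrictedProduct.inclusion (fun j : SplitIdx L => Coord L j)
          (fun j => (cube L j : Set (Coord L j))) hS) =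
      RestrictedProduct.inclusion (fun j : SplitIdx L => Coord L j) (fun j => (cube L j : Set (Coord L j))) hS ∘ F := by
    funext p
    ext j
    rfl
  rw [hcomp]
  exact (RestrictedProduct.continuous_inclusion hS).comp hF

/-- strong continuity of `ω_1 ∘ ι_i` on the open level subgroup `B_i` -/
theorem continuous_rep_one_mulSingle_level (i : Place L⁺) (w : Lp ℂ 2 (μ L)) :
    Continuous fun u : genLevel L i =>
      rep L 1 (RestrictedProduct.mulSingle (genLevel L) i (u : locTorus L⁺ L i)) w := by
  have hk : ∀ u : genLevel L i, ∀ j : SplitIdx L,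
      ‖((unitAt (RestrictedProduct.mulSingle (genLevel L) i (u : locTorus L⁺ L i)) j : (𝕂 j)ˣ) : 𝕂 j)‖ = 1 :=
    fun u j => norm_unitAt_mulSingle_of_mem_genLevel i u.2 j
  let T : genLevel L i → C(Space L, Space L) := fun u =>
    ⟨fun x => RestrictedProduct.mulSingle (genLevel L) i (u : locTorus L⁺ L i) • x, continuous_const_smul _⟩
  have hT : Continuous T := ContinuousMap.continuous_of_continuous_uncurry T (continuous_levelSMul i)
  have hmp : ∀ u, MeasurePreserving (T u) (μ L) (μ L) := fun u => measurePreserving_smul_of_norm _ (hk u)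
  have h := Continuous.compMeasurePreservingLp (E := ℂ) (p := 2) (μ := μ L) (ν := μ L)
    (f := fun _ : genLevel L i => w) (g := T) continuous_const hT hmp ENNReal.ofNat_ne_top
  convert h using 1
  funext u
  exact rep_one_eq_compMeasurePreserving _ (hk u) w

/-- **`hloc` of the END theorem for `ν = 1`**: `g ↦ ω_1(ι_i g) v` is continuous on every local group `U(1)_i`
(on `B_i` by the previous theorem; on the cosets `g₀ B_i` by the group law; at non-split `i` the action is trivial). -/
theorem continuous_rep_one_mulSingle' (i : Place L⁺) (v : Lp ℂ 2 (μ L)) :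
    Continuous fun g : locTorus L⁺ L i => rep L 1 (RestrictedProduct.mulSingle (genLevel L) i g) v := by
  have hat1 : ∀ w : Lp ℂ 2 (μ L),
      ContinuousAt (fun g : locTorus L⁺ L i => rep L 1 (RestrictedProduct.mulSingle (genLevel L) i g) w) 1 := by
    intro w
    have hon : ContinuousOn (fun g : locTorus L⁺ L i => rep L 1 (RestrictedProduct.mulSingle (genLevel L) i g) w)
        (genLevel L i : Set (locTorus L⁺ L i)) := by
      rw [continuousOn_iff_continuous_restrict]
      exact continuous_rep_one_mulSingle_level i w
    exact hon.continuousAt ((isOpen_genLevel L i).mem_nhds (one_mem _))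
  refine continuous_iff_continuousAt.2 fun g₀ => ?_
  have heq : (fun g : locTorus L⁺ L i => rep L 1 (RestrictedProduct.mulSingle (genLevel L) i g) v) =
      fun g => rep L 1 (RestrictedProduct.mulSingle (genLevel L) i g₀)
        (rep L 1 (RestrictedProduct.mulSingle (genLevel L) i (g₀⁻¹ * g)) v) := by
    funext g
    have h := map_mul (rep L 1) (RestrictedProduct.mulSingle (genLevel L) i g₀)
      (RestrictedProduct.mulSingle (genLevel L) i (g₀⁻¹ * g))
    rw [← RestrictedProduct.mulSingle_mul, mul_inv_cancel_left] at h
    rw [h, LinearIsometryEquiv.coe_mul, Function.comp_apply]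
  rw [heq]
  refine ((rep L 1 (RestrictedProduct.mulSingle (genLevel L) i g₀)).continuous.continuousAt).comp ?_
  have h2 : ContinuousAt (fun g : locTorus L⁺ L i => g₀⁻¹ * g) g₀ := (continuous_const.mul continuous_id).continuousAt
  have h3 := hat1 v
  rw [show (1 : locTorus L⁺ L i) = g₀⁻¹ * g₀ from (inv_mul_cancel g₀).symm] at h3
  exact ContinuousAt.comp (f := fun g : locTorus L⁺ L i => g₀⁻¹ * g) h3 h2

/-- **`hloc` of the END theorem**, general `ν`: given continuity of the local components `g ↦ ν(ι_i g)`. -/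
theorem continuous_rep_mulSingle (ν : Model L →* Circle)
    (hν : ∀ i : Place L⁺, Continuous fun g : locTorus L⁺ L i => ν (RestrictedProduct.mulSingle (genLevel L) i g)) :
    ∀ (i : Place L⁺) (v : Lp ℂ 2 (μ L)),
      Continuous fun g : locTorus L⁺ L i => rep L ν (RestrictedProduct.mulSingle (genLevel L) i g) v := by
  intro i v
  simp_rw [rep_eq_smul_rep_one ν]
  exact (continuous_subtype_val.comp (hν i)).smul (continuous_rep_one_mulSingle' i v)

/-- `hloc` for `ν = 1` in the exact shape of the END binder -/
theorem hloc_one : ∀ (i : Place L⁺) (v : Lp ℂ 2 (μ L)),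
    Continuous fun g : locTorus L⁺ L i => rep L 1 (RestrictedProduct.mulSingle (genLevel L) i g) v :=
  continuous_rep_one_mulSingle'

/-! ## §6  The scalar twist at the non-split places: an S3 input for an ARBITRARY character `χ` -/

variable (L) in
open Classical in
/-- the projection of the model group killing the split coordinates -/
def prNonsplit : Model L →* Model L where
  toFun k := ⟨fun j => if IsSplitPlace L j then 1 else k j, by
    filter_upwards [k.2] with j hj
    by_cases hs : IsSplitPlace L j
    · simp only [hs, if_true]; exact one_mem _
    · simp only [hs, if_false]; exact hj⟩
  map_one' := by
    ext j
    simp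
  map_mul' a b := by
    ext j
    by_cases hs : IsSplitPlace L j <;> simp [hs]

open Classical in
/-- (Ported verbatim from the HodgeCMPerL package; no docstring in the source.) -/
theorem prNonsplit_apply (k : Model L) (j : Place L⁺) :
    prNonsplit L k j = if IsSplitPlace L j then 1 else k j := rfl

/-- (Ported verbatim from the HodgeCMPerL package; no docstring in the source.) -/
theorem prNonsplit_apply_of_split (k : Model L) {j : Place L⁺} (hs : IsSplitPlace L j) : prNonsplit L k j = 1 := by
  rw [prNonsplit_apply, if_pos hs]

/-- (Ported verbatim from the HodgeCMPerL package; no docstring in the source.) -/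
theorem prNonsplit_apply_of_not (k : Model L) {j : Place L⁺} (hs : ¬IsSplitPlace L j) : prNonsplit L k j = k j := by
  rw [prNonsplit_apply, if_neg hs]

/-- (Ported verbatim from the HodgeCMPerL package; no docstring in the source.) -/
theorem prNonsplit_mulSingle_of_split {i : Place L⁺} (hs : IsSplitPlace L i) (g : locTorus L⁺ L i) :
    prNonsplit L (RestrictedProduct.mulSingle (genLevel L) i g) = 1 := by
  ext j
  by_cases hsj : IsSplitPlace L j
  · rw [prNonsplit_apply_of_split _ hsj]; rfl
  · rw [prNonsplit_apply_of_not _ hsj, RestrictedProduct.mulSingle_eq_of_ne _ _ (fun h : j = i => hsj (h ▸ hs))]; rfl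

/-- (Ported verbatim from the HodgeCMPerL package; no docstring in the source.) -/
theorem prNonsplit_mulSingle_of_not {i : Place L⁺} (hns : ¬IsSplitPlace L i) (g : locTorus L⁺ L i) :
    prNonsplit L (RestrictedProduct.mulSingle (genLevel L) i g) = RestrictedProduct.mulSingle (genLevel L) i g := by
  ext j
  by_cases hsj : IsSplitPlace L j
  · rw [prNonsplit_apply_of_split _ hsj, RestrictedProduct.mulSingle_eq_of_ne _ _ (fun h : j = i => hns (h ▸ hsj))]
  · rw [prNonsplit_apply_of_not _ hsj]

/-- (Ported verbatim from the HodgeCMPerL package; no docstring in the source.) -/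
theorem prNonsplit_mem_boxSubgroup {T : Finset (Place L⁺)} {k : Model L}
    (hk : k ∈ RestrictedProduct.boxSubgroup (genLevel L) T) : prNonsplit L k ∈ RestrictedProduct.boxSubgroup (genLevel L) T := by
  rw [RestrictedProduct.mem_boxSubgroup_iff] at hk ⊢
  refine ⟨fun j => ?_, fun j hj => ?_⟩
  · by_cases hs : IsSplitPlace L j
    · rw [prNonsplit_apply_of_split _ hs]; exact one_mem _
    · rw [prNonsplit_apply_of_not _ hs]; exact hk.1 j
  · by_cases hs : IsSplitPlace L j
    · rw [prNonsplit_apply_of_split _ hs]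
    · rw [prNonsplit_apply_of_not _ hs]; exact hk.2 j hj

variable (L) in
/-- the twisting character `ν_χ = (χ ∘ pr_nonsplit)⁻¹` -/
def twistChar (χ : Model L →* Circle) : Model L →* Circle := (χ.comp (prNonsplit L))⁻¹

/-- (Ported verbatim from the HodgeCMPerL package; no docstring in the source.) -/
theorem twistChar_apply (χ : Model L →* Circle) (k : Model L) : twistChar L χ k = (χ (prNonsplit L k))⁻¹ := rfl

/-- (Ported verbatim from the HodgeCMPerL package; no docstring in the source.) -/
theorem twistChar_mulSingle_of_split (χ : Model L →* Circle) {i : Place L⁺} (hs : IsSplitPlace L i)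
    (g : locTorus L⁺ L i) : twistChar L χ (RestrictedProduct.mulSingle (genLevel L) i g) = 1 := by
  rw [twistChar_apply, prNonsplit_mulSingle_of_split hs, map_one, inv_one]

/-- (Ported verbatim from the HodgeCMPerL package; no docstring in the source.) -/
theorem twistChar_mulSingle_of_not (χ : Model L →* Circle) {i : Place L⁺} (hns : ¬IsSplitPlace L i)
    (g : locTorus L⁺ L i) :
    twistChar L χ (RestrictedProduct.mulSingle (genLevel L) i g) = (χ (RestrictedProduct.mulSingle (genLevel L) i g))⁻¹ := by
  rw [twistChar_apply, prNonsplit_mulSingle_of_not hns]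

/-- at a split place the twisted representation is the untwisted one -/
theorem rep_twist_mulSingle_of_split (χ : Model L →* Circle) {i : Place L⁺} (hs : IsSplitPlace L i)
    (g : locTorus L⁺ L i) (w : Lp ℂ 2 (μ L)) :
    rep L (twistChar L χ) (RestrictedProduct.mulSingle (genLevel L) i g) w =
      rep L 1 (RestrictedProduct.mulSingle (genLevel L) i g) w := by
  rw [rep_eq_smul_rep_one, twistChar_mulSingle_of_split χ hs, Circle.coe_one, one_smul]

variable (L) in
/-- **The genuine global split Schrödinger model, twisted by `ν_χ`, is an S3 input for EVERY character `χ`**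
of the model group, relative to any finite set `S` of non-split places: at `v ∈ S` the (trivially acting) local
group now acts on `φ⁰` by the scalar `χ(ι_v g)⁻¹ = conj χ(ι_v g)`, which is the isotypy `hiso`. -/
def thetaInputTwist (S : Finset (Place L⁺)) (hSns : ∀ i ∈ S, ¬IsSplitPlace L i) (χ : Model L →* Circle) :
    GenuineThetaInput L S (Lp ℂ 2 (μ L)) (rep L (twistChar L χ)) (phi0 L) χ where
  ν := fun _ => 1
  hν := fun _ _ _ _ _ => rfl
  VU := fun i _ hs => V ⟨i, hs⟩
  hVUψ := fun i _ hs => V_ballIndicator ⟨i, hs⟩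
  hVU := fun i _ hs g => by
    rw [rep_twist_mulSingle_of_split χ hs]
    exact rep_mulSingle_V ⟨i, hs⟩ g _
  x₀ := fun _ => 0
  r := fun _ => 1
  a := fun _ => 0
  hr := fun i hi hs => absurd hs (hSns i hi)
  hr0 := fun i hi hs => absurd hs (hSns i hi)
  hνS := fun i hi hs => absurd hs (hSns i hi)
  hχS := fun i hi hs => absurd hs (hSns i hi)
  VS := fun i hi hs => absurd hs (hSns i hi)
  hVSψ := fun i hi hs => absurd hs (hSns i hi)
  hVS := fun i hi hs => absurd hs (hSns i hi)
  hiso := fun i hi hns g => by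
    rw [rep_eq_smul_rep_one, rep_mulSingle_of_not_isSplitPlace hns g, twistChar_mulSingle_of_not χ hns,
      Circle.coe_inv_eq_conj]

/-- NON-VACUITY of the S3 input for every `χ` -/
theorem nonempty_thetaInput_twist (S : Finset (Place L⁺)) (hSns : ∀ i ∈ S, ¬IsSplitPlace L i) (χ : Model L →* Circle) :
    Nonempty (GenuineThetaInput L S (Lp ℂ 2 (μ L)) (rep L (twistChar L χ)) (phi0 L) χ) :=
  ⟨thetaInputTwist L S hSns χ⟩

/-- `hK` for the twisted model: on any `T ⊇ T'` with `K_{T'} ≤ ker χ` -/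
theorem torusSide_hK (χ : Model L →* Circle) {T' T : Finset (Place L⁺)}
    (hχT' : RestrictedProduct.boxSubgroup (genLevel L) T' ≤ χ.ker) (hT'T : T' ⊆ T) :
    ∀ k ∈ RestrictedProduct.boxSubgroup (genLevel L) T, rep L (twistChar L χ) k (phi0 L) = phi0 L := by
  refine rep_phi0_eq_self_of_mem_boxSubgroup_of_char (twistChar L χ) T fun k hk => ?_
  rw [twistChar_apply, inv_eq_one]
  exact hχT' (boxSubgroup_antitone (genLevel L) hT'T (prNonsplit_mem_boxSubgroup hk))

/-- `hM` for the twisted model -/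
theorem torusSide_hM (χ : Model L →* Circle) (T : Finset (Place L⁺)) :
    ∀ S : Finset (Place L⁺), T ⊆ S → ∀ y : (i : ↥S) → locTorus L⁺ L i,
      inner ℂ (phi0 L) (rep L (twistChar L χ) (extendOne (genLevel L) S y) (phi0 L)) =
        ∏ i : ↥S, localCoeff (genLevel L) (rep L (twistChar L χ)) (phi0 L) i (y i) :=
  hM_phi0 (twistChar L χ) T

/-- `hloc` for the twisted model, given continuity of the local components of `χ` at the non-split places -/
theorem torusSide_hloc (χ : Model L →* Circle)
    (hχc : ∀ i : Place L⁺, ¬IsSplitPlace L i →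
      Continuous fun g : locTorus L⁺ L i => χ (RestrictedProduct.mulSingle (genLevel L) i g)) :
    ∀ (i : Place L⁺) (v : Lp ℂ 2 (μ L)),
      Continuous fun g : locTorus L⁺ L i => rep L (twistChar L χ) (RestrictedProduct.mulSingle (genLevel L) i g) v := by
  refine continuous_rep_mulSingle (twistChar L χ) fun i => ?_
  by_cases hs : IsSplitPlace L i
  · simp_rw [twistChar_mulSingle_of_split χ hs]
    exact continuous_const
  · simp_rw [twistChar_mulSingle_of_not χ hs]
    exact (hχc i hs).inv

/-- the same with the continuity derived from the END's own `χ`-side hypotheses `hχT'`, `hlocχ`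
(pv09-g4 `continuous_localChar_of_not_mem` off `T'`) -/
theorem torusSide_hloc_of_level (χ : Model L →* Circle) {T' : Finset (Place L⁺)}
    (hχT' : RestrictedProduct.boxSubgroup (genLevel L) T' ≤ χ.ker)
    (hlocχ : ∀ i ∈ T', Continuous fun g : locTorus L⁺ L i => χ (RestrictedProduct.mulSingle (genLevel L) i g)) :
    ∀ (i : Place L⁺) (v : Lp ℂ 2 (μ L)),
      Continuous fun g : locTorus L⁺ L i => rep L (twistChar L χ) (RestrictedProduct.mulSingle (genLevel L) i g) v := by
  refine torusSide_hloc χ fun i _ => ?_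
  by_cases hi : i ∈ T'
  · exact hlocχ i hi
  · exact continuous_localChar_of_not_mem (genLevel L) (isOpen_genLevel L) χ hχT' hi

/-- **SUMMARY (torus side of the S3 END theorem, all binders at once).**  For every CM field `L`, every finite set
`S` of non-split places, every character `χ` of `U(1)(𝔸_{L⁺})` with a level `T' ⊆ S` off which it is trivial and on
which its local components are continuous, the genuine global split Schrödinger model twisted by `ν_χ` supplies
`Sp, ω, φ` with: an S3 input `X`, `‖φ‖ = 1` (`hφ`), `hloc`, `hK` (for `T := T'`) and `hM` — i.e. every
`(ω, φ)`-side hypothesis of `exists_compactDomain_thetaLift_ne_zero_genuine_of_input`. -/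
theorem torusSide (S : Finset (Place L⁺)) (hSns : ∀ i ∈ S, ¬IsSplitPlace L i) (χ : Model L →* Circle)
    {T' : Finset (Place L⁺)} (hχT' : RestrictedProduct.boxSubgroup (genLevel L) T' ≤ χ.ker)
    (hlocχ : ∀ i ∈ T', Continuous fun g : locTorus L⁺ L i => χ (RestrictedProduct.mulSingle (genLevel L) i g)) :
    Nonempty (GenuineThetaInput L S (Lp ℂ 2 (μ L)) (rep L (twistChar L χ)) (phi0 L) χ) ∧
    ‖phi0 L‖ = 1 ∧
    (∀ (i : Place L⁺) (v : Lp ℂ 2 (μ L)),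
      Continuous fun g : locTorus L⁺ L i => rep L (twistChar L χ) (RestrictedProduct.mulSingle (genLevel L) i g) v) ∧
    (∀ k ∈ RestrictedProduct.boxSubgroup (genLevel L) T', rep L (twistChar L χ) k (phi0 L) = phi0 L) ∧
    (∀ S' : Finset (Place L⁺), T' ⊆ S' → ∀ y : (i : ↥S') → locTorus L⁺ L i,
      inner ℂ (phi0 L) (rep L (twistChar L χ) (extendOne (genLevel L) S' y) (phi0 L)) =
        ∏ i : ↥S', localCoeff (genLevel L) (rep L (twistChar L χ)) (phi0 L) i (y i)) :=
  ⟨nonempty_thetaInput_twist S hSns χ, norm_phi0, torusSide_hloc_of_level χ hχT' hlocχ,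
    torusSide_hK χ hχT' subset_rfl, torusSide_hM χ T'⟩


-- port_pkg: scope closed for this part
end Main
end Coeff
end SchrodingerModel
end HodgeCM.PerL34.PureTensor
end
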